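import Summits.CriticalPhenomena.PercolationContinuityZ3.Theorems.PercExchangeRateTransportTransportLemmaUpperFence
import Summits.CriticalPhenomena.PercolationContinuityZ3.Theorems.PercExchangeRateTransportTransportLemmaLowerFence
import Summits.CriticalPhenomena.PercolationContinuityZ3.Theorems.PercExchangeRateTransportTransportLemmaLevelTransport
import Summits.CriticalPhenomena.PercolationContinuityZ3.Theses.PercExchangeRateTransport

/-!
# Transport lemma of route `PercExchangeRateTransport` — assembly: the crux `TransportLemma`

Crux `Summit.CriticalPhenomena.PercolationContinuityZ3.Theses.PercExchangeRateTransport.TransportLemma`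
(stmt-CriticalPhenomena-16063), line `corrector` (tree `Cruxes/TransportLemma/Lines/corrector.lean` rev 2,
strategist planner-cstrat-stmt-CriticalPhenomena-16063-b1-0; assembly `TransportLemma_of_stubs` and
`rightContinuity` originally from line `birth`, planner-skel-stmt-CriticalPhenomena-16063-0; landed by the line
lead prover).

The abstract transport lemma (real analysis, percolation-free): for `C¹` functions `Θ n` on the open unit square,
nondecreasing in `p` (and `t`), nonincreasing in `n`, nonnegative, whose infimum `Θ∞ = ⨅ₙ Θ n` has a continuous
threshold curve `pc` on `[lo,hi] ⊂ (0,1)` with its `ρ`-collar inside the square, a field `a` continuous on the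
two-sided closed collar and `L`-Lipschitz in `p` on its right half, and for every `η > 0` the exchange-rate
inequality `|∂ₜΘ n − a ∂ₚΘ n| ≤ η ∂ₚΘ n` for `n ≥ m(η)` on `{pc t − δ(η) ≤ p ≤ pc t + ρ}`: then
`t ↦ Θ∞ (pc t) t` is constant on `[lo,hi]`.

Proof (three steps, all landed in sibling files of this line):
1. PINCHING (`curveIsCharacteristic`): the two one-sided cone bounds `stub_upperFence` (positivity propagation)
   and `stub_lowerFence` (zero propagation), with the Heine–Cantor moduli `collar_moduli` / `pc_modulus`, give
   `HasDerivWithinAt pc (−a(pc t,t)) [lo,hi] t`: the threshold curve is a characteristic of the field.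
2. LEVEL TRANSPORT (`stub_levelTransport`): along `pc ±` closed-form exponential correctors every `Θ n`,
   `n ≥ m(η)`, is monotone (fence lemma), whence `Θ∞(pc t₁,t₁) ≤ Θ∞(pc t₀+ε,t₀)` and
   `Θ∞(pc t₀,t₀) ≤ Θ∞(pc t₁+ε,t₁)` for all small `ε > 0`.
3. `ε ↓ 0` through right-continuity of `Θ∞(·,t)` at `pc t` (`rightContinuity`), and antisymmetry.
Monotonicity in `t` is never used (cf. the refuter's mutation analysis on the item). Mathlib only.
-/

namespace Summit.CriticalPhenomena.PercolationContinuityZ3.Theorems.TransportLemma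

open Filter Topology Set

/-- **Pinching: the threshold curve is a characteristic.** Under the hypotheses of the crux minus the Lipschitz
clause and monotonicity in `t` (the statement of line `birth`'s `stub_curveIsCharacteristic`, verbatim):
`HasDerivWithinAt pc (−a (pc t) t) (Icc lo hi) t` for every `t ∈ [lo,hi]`. The moduli are supplied by
`collar_moduli` / `pc_modulus`, the two one-sided cone bounds by `stub_upperFence` / `stub_lowerFence`, and
`hasDerivWithinAt_of_cone` converts them into the derivative. -/
theorem curveIsCharacteristic :
    ∀ (Θ : ℕ → ℝ → ℝ → ℝ) (pc : ℝ → ℝ) (a : ℝ → ℝ → ℝ) (lo hi ρ : ℝ),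
      0 < lo → lo < hi → hi < 1 → 0 < ρ →
      (∀ n, ContDiffOn ℝ 1 (fun x : ℝ × ℝ => Θ n x.1 x.2) (Set.Ioo 0 1 ×ˢ Set.Ioo 0 1)) →
      (∀ n t, Monotone (fun p => Θ n p t)) →
      (∀ p t, Antitone (fun n => Θ n p t)) →
      (∀ n p t, 0 ≤ Θ n p t) →
      ContinuousOn pc (Set.Icc lo hi) →
      (∀ t ∈ Set.Icc lo hi, ρ < pc t ∧ pc t + ρ < 1) →
      (∀ t ∈ Set.Icc lo hi, ∀ p : ℝ,
          (p < pc t → (⨅ n, Θ n p t) = 0) ∧ (pc t < p → 0 < ⨅ n, Θ n p t)) →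
      ContinuousOn (fun x : ℝ × ℝ => a x.1 x.2)
          {x : ℝ × ℝ | x.2 ∈ Set.Icc lo hi ∧ |x.1 - pc x.2| ≤ ρ} →
      (∀ η > (0 : ℝ), ∃ δ > (0 : ℝ), ∃ m : ℕ, ∀ n ≥ m, ∀ t ∈ Set.Icc lo hi, ∀ p : ℝ,
          pc t - δ ≤ p → p ≤ pc t + ρ →
          |deriv (fun s => Θ n p s) t - a p t * deriv (fun q => Θ n q t) p|
            ≤ η * deriv (fun q => Θ n q t) p) →
      ∀ t ∈ Set.Icc lo hi, HasDerivWithinAt pc (-(a (pc t) t)) (Set.Icc lo hi) t := by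
  intro Θ pc a lo hi ρ hlo hlohi hhi hρ hC1 hmp hanti hnn hpc hcollar hthr ha hex t ht
  obtain ⟨⟨A, hA⟩, hω⟩ := collar_moduli pc a lo hi ρ hpc ha
  have hτ := pc_modulus pc lo hi hpc
  have hUp := stub_upperFence Θ pc a lo hi ρ A hlo hlohi hhi hρ hC1 hmp hanti hnn hcollar hthr hA hω hτ hex
  have hDown := stub_lowerFence Θ pc a lo hi ρ A hlo hlohi hhi hρ hC1 hmp hanti hnn hcollar hthr hA hω hτ hex
  apply hasDerivWithinAt_of_cone pc (Set.Icc lo hi) t (-(a (pc t) t))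
  intro η hη
  obtain ⟨τ₁, hτ₁, h₁⟩ := hUp η hη
  obtain ⟨τ₂, hτ₂, h₂⟩ := hDown η hη
  refine ⟨min τ₁ τ₂, lt_min hτ₁ hτ₂, fun s hs hst => ?_⟩
  have e : pc s - pc t - (-(a (pc t) t)) * (s - t) = pc s - pc t + a (pc t) t * (s - t) := by ring
  rw [e, abs_le]
  exact ⟨h₂ t ht s hs (hst.trans (min_le_right _ _)), h₁ t ht s hs (hst.trans (min_le_left _ _))⟩

/-- **Assembly glue** (from line `birth`): the pinching statement and the level-transport statement imply the
body of the crux `TransportLemma` — compare the levels at `t` and at `hi` through `stub_levelTransport`-shaped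
transport in both time directions and let `ε ↓ 0` by right-continuity of `q ↦ ⨅ₙ Θ n q s` at `pc s`
(`rightContinuity`). -/
theorem transportLemma_of_pinch_transport
    (hPinch : ∀ (Θ : ℕ → ℝ → ℝ → ℝ) (pc : ℝ → ℝ) (a : ℝ → ℝ → ℝ) (lo hi ρ : ℝ),
      0 < lo → lo < hi → hi < 1 → 0 < ρ →
      (∀ n, ContDiffOn ℝ 1 (fun x : ℝ × ℝ => Θ n x.1 x.2) (Set.Ioo 0 1 ×ˢ Set.Ioo 0 1)) →
      (∀ n t, Monotone (fun p => Θ n p t)) →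
      (∀ p t, Antitone (fun n => Θ n p t)) →
      (∀ n p t, 0 ≤ Θ n p t) →
      ContinuousOn pc (Set.Icc lo hi) →
      (∀ t ∈ Set.Icc lo hi, ρ < pc t ∧ pc t + ρ < 1) →
      (∀ t ∈ Set.Icc lo hi, ∀ p : ℝ,
          (p < pc t → (⨅ n, Θ n p t) = 0) ∧ (pc t < p → 0 < ⨅ n, Θ n p t)) →
      ContinuousOn (fun x : ℝ × ℝ => a x.1 x.2)
          {x : ℝ × ℝ | x.2 ∈ Set.Icc lo hi ∧ |x.1 - pc x.2| ≤ ρ} →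
      (∀ η > (0 : ℝ), ∃ δ > (0 : ℝ), ∃ m : ℕ, ∀ n ≥ m, ∀ t ∈ Set.Icc lo hi, ∀ p : ℝ,
          pc t - δ ≤ p → p ≤ pc t + ρ →
          |deriv (fun s => Θ n p s) t - a p t * deriv (fun q => Θ n q t) p|
            ≤ η * deriv (fun q => Θ n q t) p) →
      ∀ t ∈ Set.Icc lo hi, HasDerivWithinAt pc (-(a (pc t) t)) (Set.Icc lo hi) t)
    (hTrans : ∀ (Θ : ℕ → ℝ → ℝ → ℝ) (pc : ℝ → ℝ) (a : ℝ → ℝ → ℝ) (lo hi ρ L : ℝ),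
      0 < lo → lo < hi → hi < 1 → 0 < ρ →
      (∀ n, ContDiffOn ℝ 1 (fun x : ℝ × ℝ => Θ n x.1 x.2) (Set.Ioo 0 1 ×ˢ Set.Ioo 0 1)) →
      (∀ n t, Monotone (fun p => Θ n p t)) →
      (∀ p t, Antitone (fun n => Θ n p t)) →
      (∀ n p t, 0 ≤ Θ n p t) →
      ContinuousOn pc (Set.Icc lo hi) →
      (∀ t ∈ Set.Icc lo hi, ρ < pc t ∧ pc t + ρ < 1) →
      ContinuousOn (fun x : ℝ × ℝ => a x.1 x.2)
          {x : ℝ × ℝ | x.2 ∈ Set.Icc lo hi ∧ pc x.2 ≤ x.1 ∧ x.1 ≤ pc x.2 + ρ} →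
      (∀ t ∈ Set.Icc lo hi, ∀ p q : ℝ, pc t ≤ p → p ≤ pc t + ρ → pc t ≤ q → q ≤ pc t + ρ →
          |a p t - a q t| ≤ L * |p - q|) →
      (∀ η > (0 : ℝ), ∃ m : ℕ, ∀ n ≥ m, ∀ t ∈ Set.Icc lo hi, ∀ p : ℝ,
          pc t ≤ p → p ≤ pc t + ρ →
          |deriv (fun s => Θ n p s) t - a p t * deriv (fun q => Θ n q t) p|
            ≤ η * deriv (fun q => Θ n q t) p) →
      (∀ t ∈ Set.Icc lo hi, HasDerivWithinAt pc (-(a (pc t) t)) (Set.Icc lo hi) t) →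
      ∀ t₀ t₁ : ℝ, lo ≤ t₀ → t₀ ≤ t₁ → t₁ ≤ hi →
        ∃ ε₀ > (0 : ℝ), ∀ ε : ℝ, 0 < ε → ε < ε₀ →
          (⨅ n, Θ n (pc t₁) t₁) ≤ (⨅ n, Θ n (pc t₀ + ε) t₀) ∧
          (⨅ n, Θ n (pc t₀) t₀) ≤ (⨅ n, Θ n (pc t₁ + ε) t₁)) :
    ∀ (Θ : ℕ → ℝ → ℝ → ℝ) (pc : ℝ → ℝ) (a : ℝ → ℝ → ℝ) (lo hi ρ L : ℝ), 0 < lo → lo < hi → hi < 1 →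
      0 < ρ → (∀ n, ContDiffOn ℝ 1 (fun x : ℝ × ℝ => Θ n x.1 x.2) (Set.Ioo 0 1 ×ˢ Set.Ioo 0 1)) →
      (∀ n t, Monotone (fun p => Θ n p t)) → (∀ n p, Monotone (fun t => Θ n p t)) →
      (∀ p t, Antitone (fun n => Θ n p t)) → (∀ n p t, 0 ≤ Θ n p t) →
      ContinuousOn pc (Set.Icc lo hi) → (∀ t ∈ Set.Icc lo hi, ρ < pc t ∧ pc t + ρ < 1) →
      (∀ t ∈ Set.Icc lo hi, ∀ p : ℝ,
          (p < pc t → (⨅ n, Θ n p t) = 0) ∧ (pc t < p → 0 < ⨅ n, Θ n p t)) →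
      ContinuousOn (fun x : ℝ × ℝ => a x.1 x.2)
          {x : ℝ × ℝ | x.2 ∈ Set.Icc lo hi ∧ |x.1 - pc x.2| ≤ ρ} →
      (∀ t ∈ Set.Icc lo hi, ∀ p q : ℝ, pc t ≤ p → p ≤ pc t + ρ → pc t ≤ q → q ≤ pc t + ρ →
          |a p t - a q t| ≤ L * |p - q|) →
      (∀ η > (0 : ℝ), ∃ δ > (0 : ℝ), ∃ m : ℕ, ∀ n ≥ m, ∀ t ∈ Set.Icc lo hi, ∀ p : ℝ,
          pc t - δ ≤ p → p ≤ pc t + ρ →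
          |deriv (fun s => Θ n p s) t - a p t * deriv (fun q => Θ n q t) p|
            ≤ η * deriv (fun q => Θ n q t) p) →
      ∀ t ∈ Set.Icc lo hi, (⨅ n, Θ n (pc t) t) = ⨅ n, Θ n (pc hi) hi := by
  intro Θ pc a lo hi ρ L hlo hlohi hhi hρ hC1 hmp hmt hanti hnn hpc hcollar hthr ha hL hex t ht
  -- (1) pinching: the curve is a characteristic of the field `a`
  have hchar : ∀ s ∈ Set.Icc lo hi, HasDerivWithinAt pc (-(a (pc s) s)) (Set.Icc lo hi) s :=
    hPinch Θ pc a lo hi ρ hlo hlohi hhi hρ hC1 hmp hanti hnn hpc hcollar hthr ha hex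
  -- (2) the transport step only needs the right closed collar
  have ha' : ContinuousOn (fun x : ℝ × ℝ => a x.1 x.2)
      {x : ℝ × ℝ | x.2 ∈ Set.Icc lo hi ∧ pc x.2 ≤ x.1 ∧ x.1 ≤ pc x.2 + ρ} := by
    refine ha.mono ?_
    rintro ⟨q, s⟩ ⟨hs, h1, h2⟩
    refine ⟨hs, ?_⟩
    rw [abs_le]
    constructor <;> linarith
  have hex' : ∀ η > (0 : ℝ), ∃ m : ℕ, ∀ n ≥ m, ∀ s ∈ Set.Icc lo hi, ∀ p : ℝ,
      pc s ≤ p → p ≤ pc s + ρ →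
      |deriv (fun r => Θ n p r) s - a p s * deriv (fun q => Θ n q s) p|
        ≤ η * deriv (fun q => Θ n q s) p := by
    intro η hη
    obtain ⟨δ, hδ, m, hm⟩ := hex η hη
    exact ⟨m, fun n hn s hs p h1 h2 => hm n hn s hs p (by linarith) h2⟩
  have hTr := hTrans Θ pc a lo hi ρ L hlo hlohi hhi hρ hC1 hmp hanti hnn hpc hcollar ha' hL hex' hchar
  -- (3) right-continuity of the level function at the curve
  have hcont : ∀ n, ContinuousOn (fun x : ℝ × ℝ => Θ n x.1 x.2) (Set.Ioo 0 1 ×ˢ Set.Ioo 0 1) :=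
    fun n => (hC1 n).continuousOn
  have hR : ∀ s ∈ Set.Icc lo hi,
      Tendsto (fun q => ⨅ n, Θ n q s) (𝓝[>] (pc s)) (𝓝 (⨅ n, Θ n (pc s) s)) := by
    intro s hs
    have hs' : s ∈ Set.Ioo (0 : ℝ) 1 := ⟨by linarith [hs.1], by linarith [hs.2]⟩
    have hpcs : pc s ∈ Set.Ioo (0 : ℝ) 1 := by
      obtain ⟨h1, h2⟩ := hcollar s hs
      exact ⟨by linarith, by linarith⟩
    exact rightContinuity Θ s hcont hmp hnn hs' (pc s) hpcs
  -- (4) compare the levels at `t` and at `hi`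
  have hhi' : hi ∈ Set.Icc lo hi := ⟨hlohi.le, le_rfl⟩
  obtain ⟨ε₀, hε₀, hε⟩ := hTr t hi ht.1 ht.2 le_rfl
  apply le_antisymm
  · refine ge_of_tendsto (hR hi hhi') ?_
    refine Filter.eventually_of_mem (Ioo_mem_nhdsGT (show pc hi < pc hi + ε₀ by linarith)) ?_
    intro q hq
    have h := (hε (q - pc hi) (by linarith [hq.1]) (by linarith [hq.2])).2
    have e : pc hi + (q - pc hi) = q := by ring
    rw [e] at h
    exact h
  · refine ge_of_tendsto (hR t ht) ?_
    refine Filter.eventually_of_mem (Ioo_mem_nhdsGT (show pc t < pc t + ε₀ by linarith)) ?_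
    intro q hq
    have h := (hε (q - pc t) (by linarith [hq.1]) (by linarith [hq.2])).1
    have e : pc t + (q - pc t) = q := by ring
    rw [e] at h
    exact h

end Summit.CriticalPhenomena.PercolationContinuityZ3.Theorems.TransportLemma

namespace Summit.CriticalPhenomena.PercolationContinuityZ3.Theorems

/-- **The crux `TransportLemma` of route `PercExchangeRateTransport`** (stmt-CriticalPhenomena-16063), concluded
BY NAME: pinching (`TransportLemma.curveIsCharacteristic`) and level transport along the exact characteristic
with closed-form exponential correctors (`TransportLemma.stub_levelTransport`) fed into the assembly glue
`TransportLemma.transportLemma_of_pinch_transport`. Percolation-free real analysis; Mathlib only. -/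
theorem percExchangeRateTransportTransportLemma_proof :
    Summit.CriticalPhenomena.PercolationContinuityZ3.Theses.PercExchangeRateTransport.TransportLemma :=
  TransportLemma.transportLemma_of_pinch_transport TransportLemma.curveIsCharacteristic
    TransportLemma.stub_levelTransport

end Summit.CriticalPhenomena.PercolationContinuityZ3.Theorems
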